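import Summits.CriticalPhenomena.PercolationContinuityZ3.Theorems.Transplant.SkelPhiConcFaceData
import Summits.CriticalPhenomena.PercolationContinuityZ3.Theorems.Transplant.SkelPhiConcKitsWin
import Summits.CriticalPhenomena.PercolationContinuityZ3.Theorems.Transplant.SkelPhiRouteDatum
import HarnessLib

/-!
# D″ node, (F) part 9 at φ-level (DPRIME-SCOPE §2 L6′; hp-8 column): the KIT CLAUSES OF THE FACE STEP — the `hkits` hypothesis of
# `Skelφ.faceOblAt_concSG` for the window target step `faceStepW … Rlev N M L' Sfin` (levels `[M+1, Rlev]`, root `w₀`, depth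
# `rE_{a'}(x, du)`, region `Win w₀ (farAS x du j) rE`, target `M_{a'}(x + du) ∪ rim`) from p1-g9's two-scale kit clause `Skelφ.kitClause'`
# with its per-contact input `hcon'` assembled by hp-8's `hcon_rim'`: FAR contacts through the slab, RIM-NEAR contacts (inner window
# poking beyond the rim radius) into the rim part, DEEP contacts by the Step-I′ inputs AT THE KIT CENTRE (`zone_at_center`,
# `link_at_center`) plus the ROUTE CLAUSE `hroute` (part 8's `routeClause_of_schedChain`, kept abstract here) — φ-level re-cut of
# `SkelConcFaceKits.hkits_faceStepW'` (hp-8 g24) over the D″ kit layer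

builds on p205010 (kernel theorem, internal audit signed; external expert review pending) — nothing in this file uses p205010.
Lane `prim-bschramm`, seat `prim-hp-8` (gen 30; L6′ (F) owner); helper file (`--supports stmt-CriticalPhenomena-4575`).  Hypotheses through
p3-g7's dictionary (`hlip hstep hfr hκ`, degree bound `hΔ`, `hC`), the Step-I′ datum `D` over `fatSeqOff off` and its certificate at the
running density `q` with accuracy `δ₂²`, the kit scalars of `kitClause'`/`kitClause_stepI` (stmt-g9's `Skelφ.Prm.*`), the face step's
rooms (`tanOff ℓs Mk ≤ M + 1`, `Rlev + 4 ≤ 10 s∥`, `Rlev + 3 ≤ 3 r⊥`, `r₀ ≤ rE`), the subbox law `Wt` on the region, the RIM NUMERICS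
(inner window depth `L`, `L + Rk i ≤ L''`, `r₀ ≤ L' ≤ rE`, `rM_{a'}(x+du) ≤ rE`; a contact whose inner window `B_G(c, L)` is not inside
`B_G(w₀, rE − L' + L'')` is served by the rim), the kit number.
* **`hkits_faceStepW'`**.
[cite: KozmaNitzan2024, §4 Lemma 10 Steps III–V (pp. 19–22), Lemma 11 (pp. 22–23), p. 30 (Step III)]
-/

noncomputable section

open MeasureTheory ProbabilityTheory
open scoped ENNReal Classical

namespace Summit.CriticalPhenomena.PercolationContinuityZ3.Theorems.Transplant

namespace Skelφ

open Literature.Probability.Percolation Literature.Probability.LatticeModels SimpleGraph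
open Literature.Probability.Percolation.KozmaNitzan
open Literature.Probability.Percolation.KozmaNitzan.Cells (oth oth_ne eq_oth_of_ne)
open Literature.Barriers.CriticalPhenomena (graphBall graphBall_finite mem_graphBall_self graphBall_mono)
open KNLevels
open Skel (winGraph winGraph_adj winGraph_le excess)
open SkelI (tanOff)
open BoxProdZ2 (ConcRadiiG)

variable {V : Type} [DecidableEq V] [Countable V] {G : SimpleGraph V} [G.LocallyFinite] {φ : V → Site 2} {types : Finset V}

/-- **THE KIT CLAUSES OF THE FACE STEP** (`hkits` of `Skelφ.faceOblAt_concSG`): at every level `j' ∈ [M + 1, Rlev]` of the window target step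
`faceStepW … Rlev N M L' Sfin`, a Step-III seed kit with Step-IV face estimates at accuracy `δ₂` towards the target `M_{a'}(x + du) ∪ rim`
inside the region `Win w₀ (farAS x du j) rE` — p1-g9's `kitClause'` with `hcon'` from `hcon_rim'`: the uniqueness zone and the kit link AT THE
KIT CENTRE of every deep contact from the Step-I′ certificate, the route clause from `hroute`.
[cite: KozmaNitzan2024, §4 Lemma 10 Steps III–V (pp. 19–22), Lemma 11 (pp. 22–23), p. 30] -/
theorem hkits_faceStepW' (hlip : Lip G φ) (hstep : Steps G φ) (hfr : Frames G φ types) (hκ : CylConn G φ types) {Δ : ℕ}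
    (hΔ : ∀ v, G.degree v ≤ Δ) {p : unitInterval} (hC : CylSubcritical G φ types p) {D : StepI.Data V} {off : ℕ}
    (hD : D.Λ = fatSeqOff hfr hC off) {Sz Sx Sy : Finset ℕ} {q : unitInterval} {δ₂ : ℝ} (hδ : 0 < δ₂)
    (h : ∀ i ∈ StepI.index types Sz Sx Sy, 1 - δ₂ ^ 2 < (bondPercolation G q).real (StepI.event G φ D i))
    -- the kit: zone scale, certified extents, half-widths, radii, slab constants and rooms (as `kitClause_stepI`)
    {Mz : ℕ} (hMz : Mz ∈ Sz) (hkz : D.k ≤ Mz) {ℓK : Fin 2 → ℕ} (hℓK0 : ∀ I, I = 0 → ℓK I ∈ Sx) (hℓK1 : ∀ I, I = 1 → ℓK I ∈ Sy)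
    {A : Fin 2 → Fin 2 → ℕ} {Rk : Fin 2 → ℕ} (hAw : ∀ I, A I = StepI.widths D.Gb D.Fb I (ℓK I)) (hRk : ∀ I, Rk I = D.R (amax (A I)))
    {ℓs Mk K R' r₀ rs : ℕ} (hℓs : 1 ≤ ℓs) (hA : ∀ i k, A i k ≤ Mk) (hAℓ : ∀ i, A i (oth i) ≤ ℓs) (hK : ∀ i, ℓs + 1 + A i i + Rk i ≤ K)
    (hnA : ∀ i, Mz + 1 ≤ A i i) (hnM : Mz ≤ Mk) (hρK : ∀ i, ℓs + 1 + A i i + (fatRadius hfr hC Mz + off) ≤ K)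
    (hR'₁ : cylRadMax G φ types ℓs (ℓs + 2 + 2 * tanOff ℓs Mk) ≤ R') (hR'₂ : ∀ i, cylRadMax G φ types ℓs (ℓs + 2 + A i i + Rk i) ≤ R')
    (hr₀₁ : ℓs + 1 + tanOff ℓs Mk + R' ≤ r₀) (hr₀₂ : ℓs + 2 + tanOff ℓs Mk + K ≤ r₀)
    (hrs₁ : ℓs + 2 + tanOff ℓs Mk + R' ≤ rs) (hrs₂ : ℓs + 2 + tanOff ℓs Mk + K ≤ rs) {cU : ℕ} (hcU : ∀ i, (Δ + 1) ^ Rk i ≤ cU)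
    (hARk : ∀ i, A i i ≤ Rk i)
    -- the face step and its rooms
    (P : PCells2) (w₀ : V) (Λ : ConcRadiiG) (a' : ℕ) (x : Site 2) (du : MDir) {j : ℕ} (hjK : j + 1 ≤ P.K) {Rlev N M L' : ℕ}
    (Sfin : Finset V) (hMt : tanOff ℓs Mk ≤ M + 1) (hRlev : Rlev + 4 ≤ 10 * P.s du.1) (hRlev' : Rlev + 3 ≤ 3 * P.r (oth du.1))
    (hr₀R : r₀ ≤ Λ.rE a' x du) {Wt : Sym2 V → unitInterval}
    (hWD : IsSubbox (winGraph G w₀ (Λ.rE a' x du)) Wt q (Win G φ w₀ (P.farAS x du j) (Λ.rE a' x du)))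
    -- the rim numerics
    {L L'' : ℕ} (hL : ∀ i, L + Rk i ≤ L'') (hr₀L' : r₀ ≤ L') (hL'R : L' ≤ Λ.rE a' x du)
    (hMR : Λ.rM a' (x + stepVec du) ≤ Λ.rE a' x du)
    -- the kit number and the count
    (kk : ℕ) (hN : kk * (Δ + 1) ^ (2 * rs) ≤ N)
    (hkk : (1 - (q : ℝ) ^ (1 + Δ * ((Δ + 1) ^ R' + (tanOff ℓs Mk + 2)) + ((Δ + 1) ^ R' + (tanOff ℓs Mk + 2)) * cU)) ^ kk ≤ δ₂)
    -- the route clause of every deep contact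
    (hroute : ∀ j' ∈ Finset.Icc (M + 1) Rlev,
      ∀ y ∈ outerBoundary (winGraph G w₀ (Λ.rE a' x du)) (winLevel G φ w₀ (Λ.rE a' x du) (P.faceLo x du j) (P.faceHi x du j) j'),
      inNbr G φ w₀ (Λ.rE a' x du) (Finset.Icc (P.faceLo x du j - (j' : Site 2)) (P.faceHi x du j + (j' : Site 2))) y ∈
        graphBall G w₀ (Λ.rE a' x du - r₀) →
      graphBall G (rectCtr hstep (deepCtr G φ w₀ (Λ.rE a' x du) (P.faceLo x du j - (j' : Site 2)) (P.faceHi x du j + (j' : Site 2)) ℓs Mk y)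
          (exitDir G φ w₀ (Λ.rE a' x du) (P.faceLo x du j - (j' : Site 2)) (P.faceHi x du j + (j' : Site 2)) y).1
          (exitDir G φ w₀ (Λ.rE a' x du) (P.faceLo x du j - (j' : Site 2)) (P.faceHi x du j + (j' : Site 2)) y).2 ℓs
          (A (exitDir G φ w₀ (Λ.rE a' x du) (P.faceLo x du j - (j' : Site 2)) (P.faceHi x du j + (j' : Site 2)) y).1)) L ⊆
        graphBall G w₀ (Λ.rE a' x du - L' + L'') →
      ∃ Qt Ft : Finset V, Ft ⊆ (faceStepW G φ P w₀ Λ a' x du j Rlev N M L' Sfin).T ∧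
        Qt ⊆ Win G φ w₀ (P.farAS x du j) (Λ.rE a' x du) ∧
        Disjoint Ft (D.Λ (rectCtr hstep (deepCtr G φ w₀ (Λ.rE a' x du) (P.faceLo x du j - (j' : Site 2)) (P.faceHi x du j + (j' : Site 2)) ℓs Mk y)
          (exitDir G φ w₀ (Λ.rE a' x du) (P.faceLo x du j - (j' : Site 2)) (P.faceHi x du j + (j' : Site 2)) y).1
          (exitDir G φ w₀ (Λ.rE a' x du) (P.faceLo x du j - (j' : Site 2)) (P.faceHi x du j + (j' : Site 2)) y).2 ℓs
          (A (exitDir G φ w₀ (Λ.rE a' x du) (P.faceLo x du j - (j' : Site 2)) (P.faceHi x du j + (j' : Site 2)) y).1)) Mz) ∧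
        1 - δ₂ ^ 2 < (prodBernoulli Wt).real (linkIn (↑Qt : Set V)
          (D.Λ (rectCtr hstep (deepCtr G φ w₀ (Λ.rE a' x du) (P.faceLo x du j - (j' : Site 2)) (P.faceHi x du j + (j' : Site 2)) ℓs Mk y)
            (exitDir G φ w₀ (Λ.rE a' x du) (P.faceLo x du j - (j' : Site 2)) (P.faceHi x du j + (j' : Site 2)) y).1
            (exitDir G φ w₀ (Λ.rE a' x du) (P.faceLo x du j - (j' : Site 2)) (P.faceHi x du j + (j' : Site 2)) y).2 ℓs
            (A (exitDir G φ w₀ (Λ.rE a' x du) (P.faceLo x du j - (j' : Site 2)) (P.faceHi x du j + (j' : Site 2)) y).1)) D.k) Ft)) :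
    let Q := faceStepW G φ P w₀ Λ a' x du j Rlev N M L' Sfin
    ∀ j' ∈ Finset.Icc Q.j₀ Q.j₁, ∃ (σ : KNLevels.SData V) (Sz : Finset V),
      KNLevels.SHyp (winLData G φ Q.root Q.Rπ Q.lo Q.hi Q.root Q.Sfin) j' σ ∧ σ.N ≤ Q.N ∧
      (1 - (q : ℝ) ^ σ.sB) ^ σ.k ≤ δ₂ ∧ Sz ⊆ (winLData G φ Q.root Q.Rπ Q.lo Q.hi Q.root Q.Sfin).X j' ∧ Sz ⊆ stepRg G φ Q ∧
      (∀ x ∈ σ.K, ∀ e' ∈ σ.seed x, e' ∉ wireSet (↑Sz : Set V)) ∧ (∀ x ∈ σ.K, σ.face x ⊆ Sz) ∧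
      (∀ x ∈ σ.K, 1 - 3 * δ₂ ≤ (prodBernoulli Wt).real {ω | ∃ u ∈ σ.face x,
        1 - δ₂ < (prodBernoulli (pinW Wt (wireSet (↑Sz : Set V)) ω)).real
          (⋃ t ∈ Q.T, openConnIn (↑(stepRg G φ Q) : Set V) u t)}) := by
  intro Q j' hj'
  have hj'' : M + 1 ≤ j' ∧ j' ≤ Rlev := Finset.mem_Icc.1 hj'
  set R := Λ.rE a' x du with hRdef
  set lo := P.faceLo x du j with hlo
  set hi := P.faceHi x du j with hhi
  -- the level box is wide, the level lies in the region
  have hwide : ∀ i, (lo - (j' : Site 2)) i + 2 * tanOff ℓs Mk ≤ (hi + (j' : Site 2)) i := fun i => by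
    have hw := faceRow_hwide P x du j hj''.1 i; rw [← hlo, ← hhi] at hw; omega
  have hXD : winLevel G φ w₀ R lo hi j' ⊆ Win G φ w₀ (P.farAS x du j) R :=
    winLevel_faceRow_subset_Win G φ P w₀ x du hjK (by omega) (by omega) R
  -- the zone family
  obtain ⟨hkn, hΛρ⟩ := fatSeqOff_kit_room (G := G) (φ := φ) hfr hC off hkz
  rw [← hD] at hkn hΛρ
  -- the per-contact dichotomy
  have hcon := hcon_rim' (G := G) (φ := φ) (w₀ := w₀) (R := R) (lo := lo) (hi := hi) (j := j') (ℓs := ℓs) (M := Mk) (A := A) (Rk := Rk)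
    (r₀ := r₀) (R' := R') hstep D.Λ (kz := D.k) (n := Mz) (q := q) (δ := δ₂) (Wt := Wt) (D := Win G φ w₀ (P.farAS x du j) R) (T := Q.T)
    (Rt := R - L' + L'') (L'' := L'') (Ldeep := L)
    (fun y hy hnear u hu => pinSet_subset_winLevel G φ w₀ R lo hi j' ℓs r₀ (shellWin_subset_pinSet G φ w₀ R lo hi j' ℓs r₀
      (rectPrism_subset_shellWin hlip hstep hwide hA hK (le_trans (by omega) hr₀₂) hr₀R hy hnear
        (nearSide_subset_rectPrismFin hstep _ _ _ ℓs _ _ hu))))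
    hARk (fun v hv hvb => ?_) (by omega) hL (by omega) (fun y hy hnear hball => ?_)
  · exact kitClause' hlip hstep hfr hκ hΔ hδ hℓs hwide hA hAℓ hK D.Λ hkn hΛρ hnA hnM hρK hR'₁ hR'₂ hr₀₁ hr₀₂ hr₀R hrs₁ hrs₂ hcU kk w₀ Sfin
      hWD hXD hN hkk hcon
  · -- a level vertex beyond `rE − L'` from the root lies in the rim part of the target
    refine Finset.mem_union_right _ (Finset.mem_filter.2 ⟨hXD hv, fun hvm => hvb (graphBall_mono G w₀ ?_ hvm)⟩)
    omega
  · -- a deep contact: zone and link at the kit centre from the certificate, the route clause from `hroute`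
    have hrectU : rectU hstep w₀ R lo hi j' ℓs Mk A Rk y =
        nearSide G hstep (deepCtr G φ w₀ R (lo - (j' : Site 2)) (hi + (j' : Site 2)) ℓs Mk y)
          (exitDir G φ w₀ R (lo - (j' : Site 2)) (hi + (j' : Site 2)) y).1 (exitDir G φ w₀ R (lo - (j' : Site 2)) (hi + (j' : Site 2)) y).2 ℓs
          (A (exitDir G φ w₀ R (lo - (j' : Site 2)) (hi + (j' : Site 2)) y).1) (Rk (exitDir G φ w₀ R (lo - (j' : Site 2)) (hi + (j' : Site 2)) y).1) :=
      rfl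
    have hr := hroute j' hj' y hy hnear hball
    rw [hrectU]
    generalize (exitDir G φ w₀ R (lo - (j' : Site 2)) (hi + (j' : Site 2)) y).1 = I at hr ⊢
    generalize (exitDir G φ w₀ R (lo - (j' : Site 2)) (hi + (j' : Site 2)) y).2 = sg at hr ⊢
    generalize deepCtr G φ w₀ R (lo - (j' : Site 2)) (hi + (j' : Site 2)) ℓs Mk y = t at hr ⊢
    set c : V := rectCtr hstep t I sg ℓs (A I) with hc
    refine ⟨zone_at_center hfr hC hD h c hMz, ?_, hr⟩
    have hl := link_at_center hfr hC hD h c I (hℓK0 I) (hℓK1 I) sg 1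
    rw [← hAw I, ← hRk I] at hl
    exact hl.trans_le (StepI.real_linkIn_rside_ge_rhalf q c (A I) (Rk I) (D.Λ c D.k) I (sg : ℤ) ((1 : ℤˣ) : ℤ))

end Skelφ

end Summit.CriticalPhenomena.PercolationContinuityZ3.Theorems.Transplant

end
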